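import Mathlib

/-!
# A1BaseChange — the base-change steps of Lemma A1.3 and Prop. A2.3(iv)
(sub-claim A1 of Tier 4, route/T4-A1-p7.md; seat p7)

Pure linear algebra over a field extension `K / k` (in the prose `k = ℚ`, `K = ℂ`, `H = H^4(B, ℚ)`):

* `mk_one_injective`: `v ↦ 1 ⊗ v` is injective (a field extension is flat and faithful over the base field);
* `mem_of_one_tmul_mem_baseChange`: a `k`-subspace `U ⊆ H` is recovered from its base change — if
  `1 ⊗ v ∈ U ⊗ K` then `v ∈ U` (Lemma A1.3: «a ℚ-subspace of a ℚ-vector space is determined by its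
  complexification, U = (U ⊗ ℂ) ∩ H»); `comap_mk_one_baseChange` is the same statement as an equality of
  subspaces;
* `baseChange_injective`: two subspaces with the same base change coincide (the last line of Lemma A1.3);
* `range_baseChange`: the image of a linear map commutes with base change (Prop. A2.3(iv):
  «W_F(B) ⊗ ℂ = (p_W ⊗ ℂ)(H^4(B, ℂ))»);
* `mem_range_iff_one_tmul_mem_range_baseChange`: for an idempotent `p`, `v ∈ range p ↔ 1 ⊗ v ∈ range (p ⊗ K)`
  (Prop. A2.3(iv): «W_F(B) = {v : p_W v = v} = {v : v ⊗ 1 ∈ W_ℂ} = W_ℂ ∩ H^4(B, ℚ)»);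
* `finrank_baseChange`: `dim_K (U ⊗ K) = dim_k U` (Prop. A2.3(iv): «dim_ℚ W_F(B) = dim_ℂ W_ℂ = 6»).

Nothing here mentions a variety: the geometric content (the projector `p_W = P([x]^*)`, the space `W_ℂ`)
is in the prose; these are the linear-algebra steps the prose invokes without a locator.
-/

namespace Summit.Ventures.HodgeRepro2.A1BaseChange

open TensorProduct

variable {k K H : Type*} [Field k] [Field K] [Algebra k K] [AddCommGroup H] [Module k H]

/-- The map `v ↦ 1 ⊗ v : H → K ⊗[k] H` is injective (`K` is flat over the field `k`, and
`algebraMap k K` is injective). -/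
theorem mk_one_injective : Function.Injective (TensorProduct.mk k K H 1) :=
  Module.Flat.tensorProduct_mk_injective k H K

/-- The base change of `U ⊆ H` is killed by the base change of the quotient map `H → H ⧸ U`. -/
theorem baseChange_le_ker_mkQ_baseChange (U : Submodule k H) :
    U.baseChange K ≤ LinearMap.ker (U.mkQ.baseChange K) := by
  have h0 : U.mkQ ∘ₗ U.subtype = 0 := by
    ext x
    simp
  rw [Submodule.baseChange, LinearMap.range_le_ker_iff, ← LinearMap.baseChange_comp, h0,
    LinearMap.baseChange_zero]

/-- Lemma A1.3, the step «a ℚ-subspace is determined by its complexification»: if `1 ⊗ v` lies in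
`U ⊗ K` then `v ∈ U`. -/
theorem mem_of_one_tmul_mem_baseChange (U : Submodule k H) {v : H}
    (hv : (1 : K) ⊗ₜ[k] v ∈ U.baseChange K) : v ∈ U := by
  have h := baseChange_le_ker_mkQ_baseChange (K := K) U hv
  rw [LinearMap.mem_ker, LinearMap.baseChange_tmul] at h
  have h0 : U.mkQ v = 0 := by
    apply mk_one_injective (k := k) (K := K)
    simpa using h
  simpa [Submodule.mkQ_apply, Submodule.Quotient.mk_eq_zero] using h0

/-- `1 ⊗ v ∈ U ⊗ K ↔ v ∈ U`. -/
theorem one_tmul_mem_baseChange_iff (U : Submodule k H) (v : H) :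
    (1 : K) ⊗ₜ[k] v ∈ U.baseChange K ↔ v ∈ U :=
  ⟨mem_of_one_tmul_mem_baseChange U, fun hv => Submodule.tmul_mem_baseChange_of_mem 1 hv⟩

/-- Lemma A1.3 as an equality of subspaces: `U = (U ⊗ K) ∩ H`, the intersection being the preimage of
`U ⊗ K` under `v ↦ 1 ⊗ v`. -/
theorem comap_mk_one_baseChange (U : Submodule k H) :
    ((U.baseChange K).restrictScalars k).comap (TensorProduct.mk k K H 1) = U := by
  ext v
  simp only [Submodule.mem_comap, Submodule.restrictScalars_mem, TensorProduct.mk_apply]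
  exact one_tmul_mem_baseChange_iff U v

/-- Two `k`-subspaces of `H` with the same base change to `K` coincide (the last line of Lemma A1.3:
`∧^4_F H^1(B, ℚ)` and `W_F(B)` both have complexification `W_ℂ`, hence are equal). -/
theorem baseChange_injective :
    Function.Injective (fun U : Submodule k H => U.baseChange K) := by
  intro U U' h
  rw [← comap_mk_one_baseChange (K := K) U, ← comap_mk_one_baseChange (K := K) U']
  simp only at h
  rw [h]

/-- The image of a linear map commutes with base change: `range (f ⊗ K) = (range f) ⊗ K`
(Prop. A2.3(iv): «W_F(B) ⊗ ℂ = (p_W ⊗ ℂ)(H^4(B, ℂ))»). -/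
theorem range_baseChange {N : Type*} [AddCommGroup N] [Module k N] (f : H →ₗ[k] N) :
    LinearMap.range (f.baseChange K) = (LinearMap.range f).baseChange K := by
  have hf : f = (LinearMap.range f).subtype ∘ₗ f.rangeRestrict := rfl
  rw [Submodule.baseChange, hf, LinearMap.baseChange_comp]
  apply LinearMap.range_comp_of_range_eq_top
  rw [LinearMap.range_eq_top, LinearMap.baseChange_eq_ltensor]
  exact LinearMap.lTensor_surjective K f.surjective_rangeRestrict

/-- An idempotent commutes with base change: `(p ⊗ K)` is again idempotent. -/
theorem isIdempotentElem_baseChange {p : Module.End k H} (hp : IsIdempotentElem p) :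
    IsIdempotentElem (p.baseChange K) := by
  unfold IsIdempotentElem at hp ⊢
  rw [← LinearMap.baseChange_mul, hp]

/-- Prop. A2.3(iv): for an idempotent `p` (the Weil projector `p_W`), `v ∈ range p ↔ 1 ⊗ v ∈ range (p ⊗ K)`
— i.e. `W_F(B) = {v : p_W v = v} = {v ∈ H^4(B, ℚ) : v ⊗ 1 ∈ W_ℂ}`, `W_ℂ = (p_W ⊗ ℂ)(H^4(B, ℂ))`. -/
theorem mem_range_iff_one_tmul_mem_range_baseChange {p : Module.End k H} (hp : IsIdempotentElem p)
    (v : H) : v ∈ LinearMap.range p ↔ (1 : K) ⊗ₜ[k] v ∈ LinearMap.range (p.baseChange K) := by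
  rw [LinearMap.IsIdempotentElem.mem_range_iff hp,
    LinearMap.IsIdempotentElem.mem_range_iff (isIdempotentElem_baseChange (K := K) hp),
    LinearMap.baseChange_tmul]
  constructor
  · intro h
    rw [h]
  · intro h
    exact mk_one_injective (k := k) (K := K) (by simpa using h)

/-- The same statement through `Submodule.baseChange`: `v ∈ range p ↔ 1 ⊗ v ∈ (range p) ⊗ K`. -/
theorem mem_range_iff_one_tmul_mem_baseChange_range {p : Module.End k H} (hp : IsIdempotentElem p)
    (v : H) : v ∈ LinearMap.range p ↔ (1 : K) ⊗ₜ[k] v ∈ (LinearMap.range p).baseChange K := by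
  rw [← range_baseChange]
  exact mem_range_iff_one_tmul_mem_range_baseChange hp v

/-- The base change of the inclusion `U → H` is injective, so `U ⊗ K ≅ U.baseChange K`. -/
theorem subtype_baseChange_injective (U : Submodule k H) :
    Function.Injective (U.subtype.baseChange K) := by
  rw [LinearMap.baseChange_eq_ltensor]
  exact Module.Flat.lTensor_preserves_injective_linearMap U.subtype U.injective_subtype

/-- `dim_K (U ⊗ K) = dim_k U` (Prop. A2.3(iv): «dim_ℚ W_F(B) = dim_ℂ W_ℂ»). -/
theorem finrank_baseChange (U : Submodule k H) :
    Module.finrank K (U.baseChange K) = Module.finrank k U := by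
  rw [Submodule.baseChange, LinearMap.finrank_range_of_inj (subtype_baseChange_injective U),
    Module.finrank_baseChange]


/-! ### Identities and isomorphisms checked after base change ((A0.3)(ii), Prop. A2.3(i)) -/

/-- An identity of `k`-linear maps may be checked after base change (Prop. A2.3(i): «`p_W² = p_W` — an
identity of ℚ-linear maps may be checked after ⊗ℂ»). -/
theorem baseChange_inj {N : Type*} [AddCommGroup N] [Module k N] {f g : H →ₗ[k] N}
    (h : f.baseChange K = g.baseChange K) : f = g := by
  apply LinearMap.baseChangeHom_injective k H K
  exact h

/-- A `k`-linear map which is injective after base change is injective. -/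
theorem injective_of_injective_baseChange {N : Type*} [AddCommGroup N] [Module k N] {f : H →ₗ[k] N}
    (hf : Function.Injective (f.baseChange K)) : Function.Injective f := by
  rw [← LinearMap.ker_eq_bot] at hf ⊢
  rw [eq_bot_iff]
  intro v hv
  rw [LinearMap.mem_ker] at hv
  have h1 : (1 : K) ⊗ₜ[k] v ∈ LinearMap.ker (f.baseChange K) := by
    rw [LinearMap.mem_ker, LinearMap.baseChange_tmul, hv, TensorProduct.tmul_zero]
  rw [hf, Submodule.mem_bot] at h1
  have h2 : v = 0 := mk_one_injective (k := k) (K := K) (by simpa using h1)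
  rw [h2]
  exact Submodule.zero_mem _

/-- A `k`-linear map which is surjective after base change is surjective. -/
theorem surjective_of_surjective_baseChange {N : Type*} [AddCommGroup N] [Module k N]
    {f : H →ₗ[k] N} (hf : Function.Surjective (f.baseChange K)) : Function.Surjective f := by
  rw [← LinearMap.range_eq_top] at hf ⊢
  rw [range_baseChange, ← Submodule.baseChange_top] at hf
  exact baseChange_injective (K := K) hf

/-- (A0.3)(ii): «a ℚ-linear map between ℚ-spaces which becomes an isomorphism after ⊗ℂ is an
isomorphism» — a `k`-linear map which is bijective after base change is bijective. -/
theorem bijective_of_bijective_baseChange {N : Type*} [AddCommGroup N] [Module k N] {f : H →ₗ[k] N}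
    (hf : Function.Bijective (f.baseChange K)) : Function.Bijective f :=
  ⟨injective_of_injective_baseChange hf.1, surjective_of_surjective_baseChange hf.2⟩

/-- Conversely, base change preserves bijectivity (both directions together: `f` is an isomorphism iff
`f ⊗ K` is). -/
theorem bijective_baseChange_iff {N : Type*} [AddCommGroup N] [Module k N] (f : H →ₗ[k] N) :
    Function.Bijective (f.baseChange K) ↔ Function.Bijective f := by
  refine ⟨bijective_of_bijective_baseChange, fun hf => ?_⟩
  let e' : H ≃ₗ[k] N := LinearEquiv.ofBijective f hf
  have : f.baseChange K = (e'.baseChange k K H N).toLinearMap := by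
    rw [LinearEquiv.coe_baseChange]
    rfl
  rw [this]
  exact (e'.baseChange k K H N).bijective

end Summit.Ventures.HodgeRepro2.A1BaseChange
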